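import Literature.AlgebraicGeometry.HodgeTheory.BettiHodgeConjectureProductsHomIntegerTwistCriteria
import Literature.AlgebraicGeometry.HodgeTheory.BettiHodgeConjectureProductsOffMiddleAlgebraicFactor
import Literature.AlgebraicGeometry.HodgeTheory.BettiHodgeConjectureTripleProducts
import HarnessLib

/-!
# Products with smooth hypersurfaces: `HC(X × Z)` and `HC(Y × Y')` as ∃-forms and as «every morphism of `ℚ`-Hodge structures `Hᵃ(Z) → Hᵐ(X)(c − n)` is induced by an algebraic class» for
# hypersurfaces of EITHER parity (even dimension under `HC(X)`), squares `HC(X × X) ⟺ End_HS(HᵐX)` algebraic, and TRIPLE PRODUCTS `(Y × Y') × Z` of two even-dimensional hypersurfaces with a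
# factor of pure even cohomology (Voisin II Cor. 1.24/1.25; Voisin I §11.3.3 Thm. 11.38–11.40, Lemma 11.41, pp. 285–287; Voisin 2025 §3.2.1; Deligne 2000 §1)

Family `hodge`, lane `lit-hodgefound` (Track 2 foundations library; Layers A1/A4), layer `Literature/AlgebraicGeometry/HodgeTheory`.  THEOREMS ONLY (no definition, no named fact, no instance;
D-0026 net debt `0`).  A smooth hypersurface `X ⊂ ℙ^{m+1}_ℂ` is OFF-MIDDLE ALGEBRAIC: `b_k(X) = 0` for odd `k ≠ m` and `Hdgᵖ(H^{2p}X) = H^{2p}(X;ℚ)` for `2p ≠ m` (Lefschetz; Voisin II Cor. 1.24/1.25 —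
TREE THEOREMS `IsSmoothHypersurface.finrank_bettiCohomology_eq_zero_of_odd`, `…hodgeClasses_hodge_eq_top_of_two_mul_ne`), and `HC(X)` holds in odd dimension (`…hodgeConjectureFor_of_odd`).  The
seat's g29/g30 files drew the consequences for ODD-dimensional hypersurfaces; gen-30 free pointer (d') asked for the EVEN-dimensional readings (under the hypothesis `HC(X)`: quadrics, cubic
fourfolds, Fermat hypersurfaces of the known degrees, …), and gen-29/30 pointer (c) for triple products.  With g31-#3's `Hom_HS` criteria (integer twists) both are one-liners, recorded here.

WHAT IS PROVED (complex orientations for the `Hom_HS` forms; `μ` any orientation family for the ∃-forms).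
* §0 **`finrank_bettiCohomology_eq_zero_of_odd_of_even`** (an even-dimensional hypersurface has no odd cohomology), **`finrank_bettiCohomology_tensor_eq_zero_of_even_of_even`** (nor has a product of two).
* §1 `X` A HYPERSURFACE WITH `HC(X)` (free for odd `m`), `Z` ANY `n`-FOLD WITH `HC(Z)`: **`hodgeConjectureFor_tensor_iff_forall_exists_corrAction_eq_left`** (`HC(X × Z)` iff every Hodge class of every piece
  `Hᵐ(X) ⊗ Hʲ(Z)`, `1 ≤ j ≤ n`, acts on `H^{2n−j}(Z;ℂ)` as some rational algebraic class does), **`hodgeConjectureFor_tensor_iff_forall_hom_tateTwist_exists_algebraic_left`** (iff every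
  `φ ∈ Hom_HS(H^{2n−j}Z, HᵐX(c − n))` is induced by an algebraic class), the `_of_odd` specialisations, and the right mirrors **`…_right`** for `Z × X`.
* §2 TWO HYPERSURFACES `Y`, `Y'` WITH `HC(Y)`, `HC(Y')`, `m + n = 2c`: **`hodgeConjectureFor_tensor_hypersurface_iff_forall_exists_corrAction_eq`**, **`hodgeConjectureFor_tensor_hypersurface_iff_forall_hom_tateTwist_exists_algebraic`**
  (`HC(Y × Y')` iff every `φ ∈ Hom_HS(HⁿY', HᵐY((m − n)/2))` is induced by a rational algebraic class of `H^{m+n}(Y × Y')`; both parities even under `HC`, or mixed — vacuous — or both odd).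
* §3 SQUARES: **`hodgeConjectureFor_tensor_self_iff_forall_end_exists_algebraic`** — for a smooth hypersurface `X` with `HC(X)`: `HC(X × X)` iff every endomorphism of the `ℚ`-Hodge structure `Hᵐ(X)` is
  induced by a rational algebraic self-correspondence.
* §4 TRIPLE PRODUCTS: for two EVEN-dimensional hypersurfaces `Y`, `Y'` (so `Y × Y'` has no odd cohomology) and `HC(Y × Y')`: **`hodgeConjectureFor_tensor_tensor_of_even_of_even_of_pure_even`** (`× Z` with
  even cohomology of pure type and `HC(Z)`), **`hodgeConjectureFor_tensor_tensor_hypersurface_of_even_of_even_of_odd`** (`× X` an odd-dimensional hypersurface), **`hodgeConjectureFor_tensor_tensor_curve_of_even_of_even`**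
  (`×` any curve), **`hodgeConjectureFor_hypersurface_tensor_tensor_of_odd_of_even_of_even`** (`X × (Y × Y')`), and the fully spelled criterion
  **`hodgeConjectureFor_tensor_tensor_hypersurface_of_forall_hom_tateTwist_exists_algebraic`**: `HC(Y)`, `HC(Y')`, every `φ ∈ Hom_HS(HⁿY', HᵐY((m − n)/2))` algebraic ⇒ `HC((Y × Y') × X)` for
  every odd-dimensional hypersurface `X`.

THE PRINTS.  C. Voisin (2003) [VoisinHodgeII2003] §1.2.2 Thm. 1.23, §1.2.3 Cor. 1.24 («`H^k(X, ℤ) ≅ H^k(ℙⁿ⁺¹, ℤ)` for `k < n`»), Cor. 1.25.  C. Voisin (2002) [VoisinHodgeI2002] §7.3.1 Def. 7.22, §7.3.2, §11.3.3 Thm.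
11.38–11.40, Lemma 11.41 and pp. 285–287.  C. Voisin (2025) [Voisin2025] §3.2.1 (12)–(14), Prop. 3.8, Cor. 3.9.  D. Arapura (2006) [Arapura2001HodgeCyclesModuli] Lemma 9, Cor. 10.  P. Deligne (2000/2006)
[Deligne2000] §1.  A. Hatcher (2002) [HatcherAT2002] §3.2 Thm. 3.16 (Künneth).

THE OBJECTS (all the tree's).  `IsSmoothHypersurface`, `IsSmoothProjective.tensor_holds`, `HodgeConjectureFor`, `BettiUniverse.hodge`, `BettiUniverse.kunnethSummand`, `BettiUniverse.crossMap`, `corrAction`,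
`HodgeStructure.Hom`, `tateTwist`, `cast`, `hodgeClasses`, `algebraicClasses`, `ofRatClass`; the seat's g31-#3 `BettiUniverse.hodgeConjectureFor_tensor_iff_forall_hom_tateTwist_exists_algebraic_left/right`,
`…_of_offMiddle_algebraic_iff_forall_hom_tateTwist_exists_algebraic`, `…tensor_self_iff_forall_end_exists_algebraic`; g30-#3 `…hodgeConjectureFor_tensor_iff_forall_exists_corrAction_eq_left/right`,
`…_of_offMiddle_algebraic_iff_forall_exists_corrAction_eq`; g28-#4 `BettiUniverse.finrank_bettiCohomology_tensor_eq_zero_of_odd`; g27-#5 `…hodgeConjectureFor_tensor_of_odd_vanishing_of_pure_even`,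
`…_of_pure_even_of_odd_vanishing`, `…hodgeConjectureFor_tensor_curve_of_odd_vanishing`; g29-#7 `IsSmoothHypersurface.finrank_bettiCohomology_eq_zero_of_odd`, `…hodgeClasses_hodge_eq_top_of_two_mul_ne`,
`…hodgeClasses_hodge_eq_top_of_odd`, `…hodgeConjectureFor_of_odd`.

DEVIATIONS / SCOPE.  `HC` of an even-dimensional hypersurface is a hypothesis wherever it enters.  No definitions.

## References
* [VoisinHodgeII2003] C. Voisin, *Hodge Theory and Complex Algebraic Geometry II* (2003) — §1.2.2 Thm. 1.23, §1.2.3 Cor. 1.24, Cor. 1.25.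
* [VoisinHodgeI2002] C. Voisin, *Hodge Theory and Complex Algebraic Geometry I* (2002) — §7.3.1 Def. 7.22; §7.3.2; §11.3.3 Thm. 11.38–11.40, Lemma 11.41, pp. 285–287.
* [Voisin2025] C. Voisin, *Cycle classes on algebraic varieties* (2025) — §3.2.1 (12)–(14), Prop. 3.8, Cor. 3.9.
* [Arapura2001HodgeCyclesModuli] D. Arapura, *Motivation for Hodge cycles* (2006) — Lemma 9, Cor. 10.
* [Deligne2000] P. Deligne, *The Hodge conjecture* (Clay problem description) — §1.
* [HatcherAT2002] A. Hatcher, *Algebraic Topology* (2002) — §3.2 Thm. 3.16.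

## Provenance
Lane `lit-hodgefound` (Hodge path, Track 2), prover seat `lit-hodgefound-p29` (generation 31), self-proposed row g31-#4 (gen-30 free pointers (c) triple products and (d') even-dimensional
hypersurfaces, through g31-#3).
-/

noncomputable section

open scoped TensorProduct
open CategoryTheory MonoidalCategory CartesianMonoidalCategory Module Finset
open Literature.AlgebraicTopology.SingularHomology
open Literature.Geometry.Kaehler

namespace Literature.AlgebraicGeometry.Motives.IsSmoothHypersurface

open Literature.AlgebraicGeometry.Motives
open Literature.AlgebraicGeometry.Motives.HodgeStructure
open Literature.AlgebraicGeometry.HodgeTheory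

variable {m n l e e' e'' d : ℕ} {X Y Y' Z C : SchemeOver ℂ}

/-! ### §0 Even-dimensional hypersurfaces have no odd cohomology -/

/-- **`b_k(X) = 0` for every odd `k`** when `X ⊂ ℙ^{m+1}_ℂ` is a smooth hypersurface of EVEN dimension `m` (`k ≠ m` automatically; Lefschetz below the middle, Poincaré duality above).
[cite: VoisinHodgeII2003, §1.2.2 Thm. 1.23 and §1.2.3 Cor. 1.24–1.25] -/
theorem finrank_bettiCohomology_eq_zero_of_odd_of_even (hX : IsSmoothHypersurface m e X) (hm : Even m) {k : ℕ} (hk : Odd k) : Module.finrank ℚ (bettiCohomology X k) = 0 :=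
  hX.finrank_bettiCohomology_eq_zero_of_odd hk fun h ↦ (Nat.not_even_iff_odd.2 hk) (h ▸ hm)

/-- **A product of two even-dimensional smooth hypersurfaces has no odd cohomology** (Künneth). [cite: VoisinHodgeII2003, §1.2.3 Cor. 1.24–1.25] [cite: HatcherAT2002, §3.2 Thm. 3.16] -/
theorem finrank_bettiCohomology_tensor_eq_zero_of_even_of_even (hY : IsSmoothHypersurface m e Y) (hY' : IsSmoothHypersurface n e' Y') (hm : Even m) (hn : Even n) {k : ℕ} (hk : Odd k) :
    Module.finrank ℚ (bettiCohomology (Y ⊗ Y') k) = 0 :=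
  BettiUniverse.finrank_bettiCohomology_tensor_eq_zero_of_odd hY.1 hY'.1 (fun _ hj ↦ hY.finrank_bettiCohomology_eq_zero_of_odd_of_even hm hj)
    (fun _ hj ↦ hY'.finrank_bettiCohomology_eq_zero_of_odd_of_even hn hj) hk

/-! ### §1 A hypersurface (with `HC`) times any variety with `HC` -/

/-- **`HC(X × Z)` for a smooth hypersurface `X` of dimension `m` with `HC(X)` and an `n`-fold `Z` with `HC(Z)` IFF every Hodge class of every piece `Hᵐ(X) ⊗ Hʲ(Z)`, `1 ≤ j ≤ n` (`m + j = 2c`), acts on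
`H^{2n−j}(Z;ℂ)` as some rational algebraic class of `H^{2c}(X × Z)` does** (`X` is off-middle algebraic, Cor. 1.24/1.25). [cite: VoisinHodgeII2003, §1.2.3 Cor. 1.24 and Cor. 1.25]
[cite: VoisinHodgeI2002, §11.3.3 Thm. 11.38–11.40, Lemma 11.41 and pp. 286–287] [cite: Voisin2025, §3.2.1 (12)–(14), Prop. 3.8 and Cor. 3.9] -/
theorem hodgeConjectureFor_tensor_iff_forall_exists_corrAction_eq_left [HodgeTensorFacts.{0, 0}] (hX : IsSmoothHypersurface m e X) (μ : OrientationFamily) (hHD : exists_isReal_hodgeModel)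
    (hHCX : HodgeConjectureFor m X) (hZ : IsSmoothProjective n Z) (hHCZ : HodgeConjectureFor n Z) :
    HodgeConjectureFor (m + n) (X ⊗ Z) ↔
      ∀ (c j a : ℕ) (hmj : m + j = 2 * c) (hab : a + 2 * c = m + 2 * n), 1 ≤ j → j ≤ n →
        ∀ t ∈ (BettiUniverse.kunnethSummand hHD hX.1 hZ (2 * c) ⟨(m, j), HasAntidiagonal.mem_antidiagonal.2 hmj⟩).hodgeClasses c,
          ∃ γ : bettiCohomology (X ⊗ Z) (2 * c), ofRatClass (ComplexPoints (X ⊗ Z)) (2 * c) γ ∈ algebraicClasses (X ⊗ Z) c ∧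
            corrAction μ hX.1 hZ hab (ofRatClass (ComplexPoints (X ⊗ Z)) (2 * c) γ) = corrAction μ hX.1 hZ hab (ofRatClass (ComplexPoints (X ⊗ Z)) (2 * c) (BettiUniverse.crossMap X Z hmj t)) :=
  BettiUniverse.hodgeConjectureFor_tensor_iff_forall_exists_corrAction_eq_left μ hHD hX.1 hZ (hX.1.tensor_holds hZ) hHCX hHCZ (fun _ hk hkm ↦ hX.finrank_bettiCohomology_eq_zero_of_odd hk hkm)
    (fun _ hp ↦ hX.hodgeClasses_hodge_eq_top_of_two_mul_ne hHD hX.1 hp)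

/-- The same for a hypersurface of ODD dimension, where `HC(X)` is a theorem. [cite: VoisinHodgeII2003, §1.2.3 Cor. 1.24 and Cor. 1.25] [cite: VoisinHodgeI2002, §11.3.3 Lemma 11.41 and pp. 286–287] -/
theorem hodgeConjectureFor_tensor_iff_forall_exists_corrAction_eq_left_of_odd [HodgeTensorFacts.{0, 0}] (hX : IsSmoothHypersurface m e X) (μ : OrientationFamily) (hHD : exists_isReal_hodgeModel)
    (hm : Odd m) (hZ : IsSmoothProjective n Z) (hHCZ : HodgeConjectureFor n Z) :
    HodgeConjectureFor (m + n) (X ⊗ Z) ↔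
      ∀ (c j a : ℕ) (hmj : m + j = 2 * c) (hab : a + 2 * c = m + 2 * n), 1 ≤ j → j ≤ n →
        ∀ t ∈ (BettiUniverse.kunnethSummand hHD hX.1 hZ (2 * c) ⟨(m, j), HasAntidiagonal.mem_antidiagonal.2 hmj⟩).hodgeClasses c,
          ∃ γ : bettiCohomology (X ⊗ Z) (2 * c), ofRatClass (ComplexPoints (X ⊗ Z)) (2 * c) γ ∈ algebraicClasses (X ⊗ Z) c ∧
            corrAction μ hX.1 hZ hab (ofRatClass (ComplexPoints (X ⊗ Z)) (2 * c) γ) = corrAction μ hX.1 hZ hab (ofRatClass (ComplexPoints (X ⊗ Z)) (2 * c) (BettiUniverse.crossMap X Z hmj t)) :=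
  hX.hodgeConjectureFor_tensor_iff_forall_exists_corrAction_eq_left μ hHD (hX.hodgeConjectureFor_of_odd hHD hm) hZ hHCZ

/-- **`HC(X × Z)` for a smooth hypersurface `X` with `HC(X)` and an `n`-fold `Z` with `HC(Z)` IFF for every `j` with `1 ≤ j ≤ n` (`m + j = 2c`, twist `r = c − n ∈ ℤ`) every morphism of `ℚ`-Hodge
structures `φ : H^{2n−j}(Z) → Hᵐ(X)(r)` is induced by a rational algebraic class of `H^{2c}(X × Z)`: `(γ ⊗ 1)_*(v ⊗ 1) = φ(v) ⊗ 1`** (complex orientations). [cite: VoisinHodgeII2003, §1.2.3 Cor. 1.24 and Cor. 1.25]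
[cite: VoisinHodgeI2002, §7.3.1 Def. 7.22, §11.3.3 Thm. 11.38–11.40, Lemma 11.41 and pp. 285–287] [cite: Voisin2025, §3.2.1 (12)–(14), Prop. 3.8 and Cor. 3.9] [cite: Deligne2000, §1] -/
theorem hodgeConjectureFor_tensor_iff_forall_hom_tateTwist_exists_algebraic_left [HodgeTensorFacts.{0, 0}] (hX : IsSmoothHypersurface m e X) (hHD : exists_isReal_hodgeModel)
    (hHCX : HodgeConjectureFor m X) (hZ : IsSmoothProjective n Z) (hHCZ : HodgeConjectureFor n Z) :
    HodgeConjectureFor (m + n) (X ⊗ Z) ↔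
      ∀ (c j a : ℕ) (r : ℤ) (_hmj : m + j = 2 * c) (hab : a + 2 * c = m + 2 * n) (_hr : ((n : ℕ) : ℤ) + r = ((c : ℕ) : ℤ)) (hw : ((m : ℕ) : ℤ) - 2 * r = ((a : ℕ) : ℤ)), 1 ≤ j → j ≤ n →
        ∀ φ : HodgeStructure.Hom (BettiUniverse.hodge hHD hZ a) (((BettiUniverse.hodge hHD hX.1 m).tateTwist r).cast hw),
          ∃ γ : bettiCohomology (X ⊗ Z) (2 * c), ofRatClass (ComplexPoints (X ⊗ Z)) (2 * c) γ ∈ algebraicClasses (X ⊗ Z) c ∧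
            ∀ v, corrAction complexOrientationFamily hX.1 hZ hab (ofRatClass (ComplexPoints (X ⊗ Z)) (2 * c) γ) (ofRatClass (ComplexPoints Z) a v) = ofRatClass (ComplexPoints X) m (φ.toLinearMap v) :=
  BettiUniverse.hodgeConjectureFor_tensor_iff_forall_hom_tateTwist_exists_algebraic_left hHD hX.1 hZ (hX.1.tensor_holds hZ) hHCX hHCZ (fun _ hk hkm ↦ hX.finrank_bettiCohomology_eq_zero_of_odd hk hkm)
    (fun _ hp ↦ hX.hodgeClasses_hodge_eq_top_of_two_mul_ne hHD hX.1 hp)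

/-- The same for a hypersurface of ODD dimension (`HC(X)` free). [cite: VoisinHodgeII2003, §1.2.3 Cor. 1.24 and Cor. 1.25] [cite: VoisinHodgeI2002, §7.3.1 Def. 7.22, §11.3.3 Lemma 11.41 and pp. 285–287] -/
theorem hodgeConjectureFor_tensor_iff_forall_hom_tateTwist_exists_algebraic_left_of_odd [HodgeTensorFacts.{0, 0}] (hX : IsSmoothHypersurface m e X) (hHD : exists_isReal_hodgeModel) (hm : Odd m)
    (hZ : IsSmoothProjective n Z) (hHCZ : HodgeConjectureFor n Z) :
    HodgeConjectureFor (m + n) (X ⊗ Z) ↔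
      ∀ (c j a : ℕ) (r : ℤ) (_hmj : m + j = 2 * c) (hab : a + 2 * c = m + 2 * n) (_hr : ((n : ℕ) : ℤ) + r = ((c : ℕ) : ℤ)) (hw : ((m : ℕ) : ℤ) - 2 * r = ((a : ℕ) : ℤ)), 1 ≤ j → j ≤ n →
        ∀ φ : HodgeStructure.Hom (BettiUniverse.hodge hHD hZ a) (((BettiUniverse.hodge hHD hX.1 m).tateTwist r).cast hw),
          ∃ γ : bettiCohomology (X ⊗ Z) (2 * c), ofRatClass (ComplexPoints (X ⊗ Z)) (2 * c) γ ∈ algebraicClasses (X ⊗ Z) c ∧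
            ∀ v, corrAction complexOrientationFamily hX.1 hZ hab (ofRatClass (ComplexPoints (X ⊗ Z)) (2 * c) γ) (ofRatClass (ComplexPoints Z) a v) = ofRatClass (ComplexPoints X) m (φ.toLinearMap v) :=
  hX.hodgeConjectureFor_tensor_iff_forall_hom_tateTwist_exists_algebraic_left hHD (hX.hodgeConjectureFor_of_odd hHD hm) hZ hHCZ

/-- **Right mirror: `HC(Z × X)` for an `n`-fold `Z` with `HC(Z)` and a smooth hypersurface `X` of dimension `m` with `HC(X)` IFF for every `i` with `1 ≤ i ≤ n` (`i + m = 2c`, twist `r = c − m`) every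
morphism of `ℚ`-Hodge structures `φ : Hᵐ(X) → Hⁱ(Z)(r)` is induced by a rational algebraic class of `H^{2c}(Z × X)`.** [cite: VoisinHodgeII2003, §1.2.3 Cor. 1.24 and Cor. 1.25]
[cite: VoisinHodgeI2002, §7.3.1 Def. 7.22, §11.3.3 Thm. 11.38–11.40, Lemma 11.41 and pp. 285–287] [cite: Voisin2025, §3.2.1 (12)–(14), Prop. 3.8 and Cor. 3.9] [cite: Deligne2000, §1] -/
theorem hodgeConjectureFor_tensor_iff_forall_hom_tateTwist_exists_algebraic_right [HodgeTensorFacts.{0, 0}] (hX : IsSmoothHypersurface m e X) (hHD : exists_isReal_hodgeModel)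
    (hHCX : HodgeConjectureFor m X) (hZ : IsSmoothProjective n Z) (hHCZ : HodgeConjectureFor n Z) :
    HodgeConjectureFor (n + m) (Z ⊗ X) ↔
      ∀ (c i : ℕ) (r : ℤ) (_him : i + m = 2 * c) (hab : m + 2 * c = i + 2 * m) (_hr : ((m : ℕ) : ℤ) + r = ((c : ℕ) : ℤ)) (hw : ((i : ℕ) : ℤ) - 2 * r = ((m : ℕ) : ℤ)), 1 ≤ i → i ≤ n →
        ∀ φ : HodgeStructure.Hom (BettiUniverse.hodge hHD hX.1 m) (((BettiUniverse.hodge hHD hZ i).tateTwist r).cast hw),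
          ∃ γ : bettiCohomology (Z ⊗ X) (2 * c), ofRatClass (ComplexPoints (Z ⊗ X)) (2 * c) γ ∈ algebraicClasses (Z ⊗ X) c ∧
            ∀ v, corrAction complexOrientationFamily hZ hX.1 hab (ofRatClass (ComplexPoints (Z ⊗ X)) (2 * c) γ) (ofRatClass (ComplexPoints X) m v) = ofRatClass (ComplexPoints Z) i (φ.toLinearMap v) :=
  BettiUniverse.hodgeConjectureFor_tensor_iff_forall_hom_tateTwist_exists_algebraic_right hHD hZ hX.1 (hZ.tensor_holds hX.1) hHCZ hHCX (fun _ hk hkm ↦ hX.finrank_bettiCohomology_eq_zero_of_odd hk hkm)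
    (fun _ hp ↦ hX.hodgeClasses_hodge_eq_top_of_two_mul_ne hHD hX.1 hp)

/-! ### §2 Two hypersurfaces with `HC` -/

/-- **`HC(Y × Y')` for two smooth hypersurfaces with `HC(Y)`, `HC(Y')` and `m + n = 2c` IFF every Hodge class of `Hᵐ(Y) ⊗ Hⁿ(Y')` acts on `Hⁿ(Y';ℂ) → Hᵐ(Y;ℂ)` as an algebraic correspondence does**
(any parities; both factors off-middle algebraic). [cite: VoisinHodgeII2003, §1.2.3 Cor. 1.24 and Cor. 1.25] [cite: VoisinHodgeI2002, §11.3.3 Thm. 11.38–11.40, Lemma 11.41 and pp. 286–287] [cite: Voisin2025, §3.2.1 (12)–(14), Prop. 3.8 and Cor. 3.9] -/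
theorem hodgeConjectureFor_tensor_hypersurface_iff_forall_exists_corrAction_eq [HodgeTensorFacts.{0, 0}] (hY : IsSmoothHypersurface m e Y) (hY' : IsSmoothHypersurface n e' Y') (μ : OrientationFamily)
    (hHD : exists_isReal_hodgeModel) (hHC : HodgeConjectureFor m Y) (hHC' : HodgeConjectureFor n Y') {c : ℕ} (hmn : m + n = 2 * c) (hab : n + 2 * c = m + 2 * n) :
    HodgeConjectureFor (m + n) (Y ⊗ Y') ↔
      ∀ t ∈ (BettiUniverse.kunnethSummand hHD hY.1 hY'.1 (2 * c) ⟨(m, n), HasAntidiagonal.mem_antidiagonal.2 hmn⟩).hodgeClasses c,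
        ∃ γ : bettiCohomology (Y ⊗ Y') (2 * c), ofRatClass (ComplexPoints (Y ⊗ Y')) (2 * c) γ ∈ algebraicClasses (Y ⊗ Y') c ∧
          corrAction μ hY.1 hY'.1 hab (ofRatClass (ComplexPoints (Y ⊗ Y')) (2 * c) γ) = corrAction μ hY.1 hY'.1 hab (ofRatClass (ComplexPoints (Y ⊗ Y')) (2 * c) (BettiUniverse.crossMap Y Y' hmn t)) :=
  BettiUniverse.hodgeConjectureFor_tensor_of_offMiddle_algebraic_iff_forall_exists_corrAction_eq μ hHD hY.1 hY'.1 (hY.1.tensor_holds hY'.1) hHC hHC'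
    (fun _ hk hkm ↦ hY.finrank_bettiCohomology_eq_zero_of_odd hk hkm) (fun _ hp ↦ hY.hodgeClasses_hodge_eq_top_of_two_mul_ne hHD hY.1 hp)
    (fun _ hk hkn ↦ hY'.finrank_bettiCohomology_eq_zero_of_odd hk hkn) (fun _ hp ↦ hY'.hodgeClasses_hodge_eq_top_of_two_mul_ne hHD hY'.1 hp) hmn hab

/-- **`HC(Y × Y')` for two smooth hypersurfaces with `HC(Y)`, `HC(Y')` and `m + n = 2c` (twist `r = c − n = (m − n)/2 ∈ ℤ`) IFF every morphism of `ℚ`-Hodge structures `φ : Hⁿ(Y') → Hᵐ(Y)(r)` is induced by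
a rational algebraic class of `H^{m+n}(Y × Y')`** (complex orientations). [cite: VoisinHodgeII2003, §1.2.3 Cor. 1.24 and Cor. 1.25] [cite: VoisinHodgeI2002, §7.3.1 Def. 7.22, §7.3.2, §11.3.3 Lemma 11.41 and pp. 285–287]
[cite: Voisin2025, §3.2.1 (12)–(14), Prop. 3.8 and Cor. 3.9] [cite: Deligne2000, §1] -/
theorem hodgeConjectureFor_tensor_hypersurface_iff_forall_hom_tateTwist_exists_algebraic [HodgeTensorFacts.{0, 0}] (hY : IsSmoothHypersurface m e Y) (hY' : IsSmoothHypersurface n e' Y')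
    (hHD : exists_isReal_hodgeModel) (hHC : HodgeConjectureFor m Y) (hHC' : HodgeConjectureFor n Y') {c : ℕ} {r : ℤ} (hmn : m + n = 2 * c) (hab : n + 2 * c = m + 2 * n)
    (hr : ((n : ℕ) : ℤ) + r = ((c : ℕ) : ℤ)) (hw : ((m : ℕ) : ℤ) - 2 * r = ((n : ℕ) : ℤ)) :
    HodgeConjectureFor (m + n) (Y ⊗ Y') ↔
      ∀ φ : HodgeStructure.Hom (BettiUniverse.hodge hHD hY'.1 n) (((BettiUniverse.hodge hHD hY.1 m).tateTwist r).cast hw),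
        ∃ γ : bettiCohomology (Y ⊗ Y') (2 * c), ofRatClass (ComplexPoints (Y ⊗ Y')) (2 * c) γ ∈ algebraicClasses (Y ⊗ Y') c ∧
          ∀ v, corrAction complexOrientationFamily hY.1 hY'.1 hab (ofRatClass (ComplexPoints (Y ⊗ Y')) (2 * c) γ) (ofRatClass (ComplexPoints Y') n v) = ofRatClass (ComplexPoints Y) m (φ.toLinearMap v) :=
  BettiUniverse.hodgeConjectureFor_tensor_of_offMiddle_algebraic_iff_forall_hom_tateTwist_exists_algebraic hHD hY.1 hY'.1 (hY.1.tensor_holds hY'.1) hHC hHC'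
    (fun _ hk hkm ↦ hY.finrank_bettiCohomology_eq_zero_of_odd hk hkm) (fun _ hp ↦ hY.hodgeClasses_hodge_eq_top_of_two_mul_ne hHD hY.1 hp)
    (fun _ hk hkn ↦ hY'.finrank_bettiCohomology_eq_zero_of_odd hk hkn) (fun _ hp ↦ hY'.hodgeClasses_hodge_eq_top_of_two_mul_ne hHD hY'.1 hp) hmn hab hr hw

/-! ### §3 Squares -/

/-- **`HC(X × X)` for a smooth hypersurface `X` of dimension `m` with `HC(X)` (free for odd `m`) IFF every endomorphism of the `ℚ`-Hodge structure `Hᵐ(X)` is induced by a rational algebraic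
self-correspondence of `X`: `(γ ⊗ 1)_*(v ⊗ 1) = φ(v) ⊗ 1`.** [cite: VoisinHodgeII2003, §1.2.3 Cor. 1.24 and Cor. 1.25] [cite: VoisinHodgeI2002, §7.3.1 Def. 7.22, §11.3.3 Lemma 11.41 and pp. 285–287]
[cite: Voisin2025, §3.2.1 (12)–(14), Prop. 3.8 and Cor. 3.9] [cite: Deligne2000, §1] -/
theorem hodgeConjectureFor_tensor_self_iff_forall_end_exists_algebraic [HodgeTensorFacts.{0, 0}] (hX : IsSmoothHypersurface m e X) (hHD : exists_isReal_hodgeModel) (hHC : HodgeConjectureFor m X) :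
    HodgeConjectureFor (m + m) (X ⊗ X) ↔
      ∀ φ : HodgeStructure.Hom (BettiUniverse.hodge hHD hX.1 m) (BettiUniverse.hodge hHD hX.1 m),
        ∃ γ : bettiCohomology (X ⊗ X) (2 * m), ofRatClass (ComplexPoints (X ⊗ X)) (2 * m) γ ∈ algebraicClasses (X ⊗ X) m ∧
          ∀ v, corrAction complexOrientationFamily hX.1 hX.1 (rfl : m + 2 * m = m + 2 * m) (ofRatClass (ComplexPoints (X ⊗ X)) (2 * m) γ) (ofRatClass (ComplexPoints X) m v) =
            ofRatClass (ComplexPoints X) m (φ.toLinearMap v) :=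
  BettiUniverse.hodgeConjectureFor_tensor_self_iff_forall_end_exists_algebraic hHD hX.1 (hX.1.tensor_holds hX.1) hHC (fun _ hk hkm ↦ hX.finrank_bettiCohomology_eq_zero_of_odd hk hkm)
    (fun _ hp ↦ hX.hodgeClasses_hodge_eq_top_of_two_mul_ne hHD hX.1 hp)

/-! ### §4 Triple products with two even-dimensional hypersurfaces -/

/-- **`HC((Y × Y') × Z) ⟸ HC(Y × Y') ∧ HC(Z)`** for two smooth hypersurfaces `Y`, `Y'` of EVEN dimensions and any `Z` with even cohomology of pure type (`Hdgᵇ(H^{2b}Z) = ⊤` for all `b`): `Y × Y'` has no odd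
cohomology (§0), so the transfer «no odd cohomology × pure even cohomology» applies. [cite: VoisinHodgeII2003, §1.2.3 Cor. 1.24–1.25] [cite: VoisinHodgeI2002, §11.3.3 Thm. 11.38, Lemma 11.41 and p. 287]
[cite: Arapura2001HodgeCyclesModuli, Lemma 9 and Cor. 10] -/
theorem hodgeConjectureFor_tensor_tensor_of_even_of_even_of_pure_even (hY : IsSmoothHypersurface m e Y) (hY' : IsSmoothHypersurface n e' Y') (hHD : exists_isReal_hodgeModel) (hm : Even m) (hn : Even n)
    (hHC2 : HodgeConjectureFor (m + n) (Y ⊗ Y')) (hZ : IsSmoothProjective l Z) (hd : IsSmoothProjective d ((Y ⊗ Y') ⊗ Z)) (hevZ : ∀ b : ℕ, (BettiUniverse.hodge hHD hZ (2 * b)).hodgeClasses b = ⊤)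
    (hHCZ : HodgeConjectureFor l Z) : HodgeConjectureFor d ((Y ⊗ Y') ⊗ Z) := by
  haveI : HodgeTensorFacts.{0, 0} := hodgeTensorFacts_holds
  exact BettiUniverse.hodgeConjectureFor_tensor_of_odd_vanishing_of_pure_even hHD (hY.1.tensor_holds hY'.1) hZ hd
    (fun _ hk ↦ hY.finrank_bettiCohomology_tensor_eq_zero_of_even_of_even hY' hm hn hk) hevZ hHC2 hHCZ

/-- **`HC((Y × Y') × X) ⟸ HC(Y × Y')`** for two even-dimensional smooth hypersurfaces `Y`, `Y'` and an ODD-dimensional smooth hypersurface `X` (whose even cohomology is of pure type and which satisfies `HC`).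
[cite: VoisinHodgeII2003, §1.2.3 Cor. 1.24–1.25] [cite: VoisinHodgeI2002, §11.3.3 Thm. 11.38, Lemma 11.41 and p. 287] [cite: Arapura2001HodgeCyclesModuli, Lemma 9 and Cor. 10] -/
theorem hodgeConjectureFor_tensor_tensor_hypersurface_of_even_of_even_of_odd (hY : IsSmoothHypersurface m e Y) (hY' : IsSmoothHypersurface n e' Y') (hX : IsSmoothHypersurface l e'' X)
    (hHD : exists_isReal_hodgeModel) (hm : Even m) (hn : Even n) (hl : Odd l) (hHC2 : HodgeConjectureFor (m + n) (Y ⊗ Y')) : HodgeConjectureFor (m + n + l) ((Y ⊗ Y') ⊗ X) :=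
  hY.hodgeConjectureFor_tensor_tensor_of_even_of_even_of_pure_even hY' hHD hm hn hHC2 hX.1 ((hY.1.tensor_holds hY'.1).tensor_holds hX.1) (hX.hodgeClasses_hodge_eq_top_of_odd hHD hX.1 hl)
    (hX.hodgeConjectureFor_of_odd hHD hl)

/-- **`HC((Y × Y') × C) ⟸ HC(Y × Y')`** for two even-dimensional smooth hypersurfaces and EVERY smooth projective curve `C`. [cite: VoisinHodgeII2003, §1.2.3 Cor. 1.24–1.25] [cite: VoisinHodgeI2002, §11.3.3 Thm. 11.38, Lemma 11.41 and p. 287]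
[cite: Arapura2001HodgeCyclesModuli, Lemma 9] -/
theorem hodgeConjectureFor_tensor_tensor_curve_of_even_of_even (hY : IsSmoothHypersurface m e Y) (hY' : IsSmoothHypersurface n e' Y') (hHD : exists_isReal_hodgeModel) (hm : Even m) (hn : Even n)
    (hHC2 : HodgeConjectureFor (m + n) (Y ⊗ Y')) (hC : IsSmoothProjective 1 C) (hd : IsSmoothProjective d ((Y ⊗ Y') ⊗ C)) : HodgeConjectureFor d ((Y ⊗ Y') ⊗ C) := by
  haveI : HodgeTensorFacts.{0, 0} := hodgeTensorFacts_holds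
  exact BettiUniverse.hodgeConjectureFor_tensor_curve_of_odd_vanishing hHD (hY.1.tensor_holds hY'.1) hC hd (fun _ hk ↦ hY.finrank_bettiCohomology_tensor_eq_zero_of_even_of_even hY' hm hn hk) hHC2

/-- **`HC(X × (Y × Y')) ⟸ HC(Y × Y')`** for an odd-dimensional smooth hypersurface `X` and two even-dimensional ones (the mirror of the previous transfer). [cite: VoisinHodgeII2003, §1.2.3 Cor. 1.24–1.25]
[cite: VoisinHodgeI2002, §11.3.3 Thm. 11.38, Lemma 11.41 and p. 287] [cite: Arapura2001HodgeCyclesModuli, Lemma 9 and Cor. 10] -/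
theorem hodgeConjectureFor_hypersurface_tensor_tensor_of_odd_of_even_of_even (hX : IsSmoothHypersurface l e'' X) (hY : IsSmoothHypersurface m e Y) (hY' : IsSmoothHypersurface n e' Y')
    (hHD : exists_isReal_hodgeModel) (hl : Odd l) (hm : Even m) (hn : Even n) (hHC2 : HodgeConjectureFor (m + n) (Y ⊗ Y')) : HodgeConjectureFor (l + (m + n)) (X ⊗ (Y ⊗ Y')) := by
  haveI : HodgeTensorFacts.{0, 0} := hodgeTensorFacts_holds
  exact BettiUniverse.hodgeConjectureFor_tensor_of_pure_even_of_odd_vanishing hHD hX.1 (hY.1.tensor_holds hY'.1) (hX.1.tensor_holds (hY.1.tensor_holds hY'.1))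
    (hX.hodgeClasses_hodge_eq_top_of_odd hHD hX.1 hl) (fun _ hk ↦ hY.finrank_bettiCohomology_tensor_eq_zero_of_even_of_even hY' hm hn hk) (hX.hodgeConjectureFor_of_odd hHD hl) hHC2

/-- **The spelled-out criterion for `(Y × Y') × X`**: two even-dimensional smooth hypersurfaces `Y`, `Y'` with `HC(Y)`, `HC(Y')` (`m + n = 2c`, twist `r = c − n`) such that every morphism of `ℚ`-Hodge
structures `Hⁿ(Y') → Hᵐ(Y)(r)` is induced by a rational algebraic class of `H^{m+n}(Y × Y')`, and any odd-dimensional smooth hypersurface `X`: then `HC((Y × Y') × X)`.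
[cite: VoisinHodgeII2003, §1.2.3 Cor. 1.24–1.25] [cite: VoisinHodgeI2002, §7.3.1 Def. 7.22, §11.3.3 Thm. 11.38–11.40, Lemma 11.41 and pp. 285–287] [cite: Voisin2025, §3.2.1 (12)–(14), Prop. 3.8 and Cor. 3.9] -/
theorem hodgeConjectureFor_tensor_tensor_hypersurface_of_forall_hom_tateTwist_exists_algebraic [HodgeTensorFacts.{0, 0}] (hY : IsSmoothHypersurface m e Y) (hY' : IsSmoothHypersurface n e' Y')
    (hX : IsSmoothHypersurface l e'' X) (hHD : exists_isReal_hodgeModel) (hm : Even m) (hn : Even n) (hl : Odd l) (hHC : HodgeConjectureFor m Y) (hHC' : HodgeConjectureFor n Y') {c : ℕ} {r : ℤ}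
    (hmn : m + n = 2 * c) (hab : n + 2 * c = m + 2 * n) (hr : ((n : ℕ) : ℤ) + r = ((c : ℕ) : ℤ)) (hw : ((m : ℕ) : ℤ) - 2 * r = ((n : ℕ) : ℤ))
    (h : ∀ φ : HodgeStructure.Hom (BettiUniverse.hodge hHD hY'.1 n) (((BettiUniverse.hodge hHD hY.1 m).tateTwist r).cast hw),
      ∃ γ : bettiCohomology (Y ⊗ Y') (2 * c), ofRatClass (ComplexPoints (Y ⊗ Y')) (2 * c) γ ∈ algebraicClasses (Y ⊗ Y') c ∧
        ∀ v, corrAction complexOrientationFamily hY.1 hY'.1 hab (ofRatClass (ComplexPoints (Y ⊗ Y')) (2 * c) γ) (ofRatClass (ComplexPoints Y') n v) = ofRatClass (ComplexPoints Y) m (φ.toLinearMap v)) :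
    HodgeConjectureFor (m + n + l) ((Y ⊗ Y') ⊗ X) :=
  hY.hodgeConjectureFor_tensor_tensor_hypersurface_of_even_of_even_of_odd hY' hX hHD hm hn hl
    ((hY.hodgeConjectureFor_tensor_hypersurface_iff_forall_hom_tateTwist_exists_algebraic hY' hHD hHC hHC' hmn hab hr hw).2 h)

end Literature.AlgebraicGeometry.Motives.IsSmoothHypersurface

end
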